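import Summits.AnomalousDissipation.AnomalousDissipation.Theorems.MarginalStabilityChainStrainedLayerLawStubStrainWorkIdentityA
import HarnessLib

/-!
# Stub `stub_strainWorkIdentity` of line `strain-work-sum-rule` (crux `MarginalStabilityChain.StrainedLayerLaw`,
# stmt-AnomalousDissipation-3007) — tool file B: the energy identity at a fixed time slice

Support file (`--supports stmt-AnomalousDissipation-3007`; registered sub-goal `stub_strainWorkIdentity_slice`),
everything proved. For a classical solution `(u, v, p)` of the stretched two-dimensional Navier–Stokes shear layer
system `IsStretchedLayerNSSolutionOn (Ioi 0) ν 1 1 L u v p` (`γ = ΔU = 1`, period `L > 0`) and a time `t > 0`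
at which the slice has shear tails `SliceTails C k (u t) (v t)` and `|∂ₜu| + |∂ₜv| ≤ Ce^{−k|y|}`:

  `∫∫_{(0,L]×ℝ} (u ∂ₜu + v ∂ₜv) = ∫∫_{(0,L]×ℝ} (¼ − u² + v²)/2 − ν ∫∫_{(0,L]×ℝ} |∇(u, v)|²`

(Majda–Bertozzi 2002, *Vorticity and Incompressible Flow*, §3.1.1 p. 87–88, basic energy identity on the period
strip, with the strain drift `div (u, v − y) = −1` and the stretching `−v·v` added): pair the momentum equations
with `(u, v)`; transport `−∫∫ e`, `e = (u² + v² − ¼)/2` (`integral_strip_transport`); pressure `0`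
(`integral_strip_pressure_eq_zero`; `∇p`, read off the momentum equations, grows at most linearly, `p` at most
quadratically across the layer); viscosity `−ν∫∫|∇(u,v)|²` (`stub_strainWorkIdentity_viscous`, tool file A).
-/

-- `Summit.<Summit>.<Problem>` is the tree's mandated summit-side namespace (CONVENTIONS §2); for this
-- single-conjunct summit the two coincide, so the duplicate is deliberate.
set_option linter.dupNamespace false

noncomputable section

open scoped Topology ENNReal
open Filter Set Function MeasureTheory

namespace Summit.AnomalousDissipation.AnomalousDissipation.Theorems.StrainedLayerLaw.StrainWorkSumRule

open Literature.Analysis.FluidPDE Literature.Analysis.FluidPDE.StretchedLayer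

/-! ## The energy identity at a fixed time slice -/

section Slice

/-- `(1 + |y|)e^{−k|y|} ≤ (1 + |y|)²e^{−k|y|}`. [folklore] -/
theorem one_add_abs_mul_exp_le_sq (k y : ℝ) :
    (1 + |y|) * Real.exp (-k * |y|) ≤ (1 + |y|) ^ 2 * Real.exp (-k * |y|) := by
  have h1 : (1 + |y|) ≤ (1 + |y|) ^ 2 := by nlinarith [abs_nonneg y]
  exact mul_le_mul_of_nonneg_right h1 (Real.exp_pos _).le

/-- **The energy identity of the stretched shear layer at a fixed time** (registered sub-goal
`stub_strainWorkIdentity_slice`). For a classical solution `(u, v, p)` of the stretched two-dimensional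
Navier–Stokes layer system (`γ = ΔU = 1`, period `L > 0`) on the time set `(0, ∞)` and a time `t > 0` at which the
slice has shear tails `SliceTails C k (u t) (v t)` (`k > 0`) and the time derivatives decay like `Ce^{−k|y|}`:
the three strip integrands below are integrable on `(0, L] × ℝ` and
`∫∫ (u ∂ₜu + v ∂ₜv) = ∫∫ (¼ − u² + v²)/2 − ν ∫∫ |∇(u, v)|²`.
Proof (Majda–Bertozzi 2002, §3.1.1 basic energy identity, with the strain drift): pair the momentum equations
with `(u, v)`; transport `−∫∫ (u∂ₓe + (v − y)∂_ye) = −∫∫ e`, `e = (u² + v² − ¼)/2` (`div (u, v − y) = −1`,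
`integral_strip_transport`); stretching `+∫∫ v²`; pressure `0` (`integral_strip_pressure_eq_zero`, the pressure
gradient read off the momentum equations grows at most quadratically); viscosity `−ν∫∫|∇(u,v)|²`
(`stub_strainWorkIdentity_viscous`). [folklore] -/
theorem stub_strainWorkIdentity_slice : ∀ (ν L t C k : ℝ) (u v p : ℝ → ℝ → ℝ → ℝ), 0 < L → 0 < t → 0 < k →
    IsStretchedLayerNSSolutionOn (Ioi 0) ν 1 1 L u v p → SliceTails C k (u t) (v t) →
    (∀ x y, |deriv (fun s => u s x y) t| + |deriv (fun s => v s x y) t| ≤ C * Real.exp (-k * |y|)) →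
      IntegrableOn (fun q : ℝ × ℝ => u t q.1 q.2 * deriv (fun s => u s q.1 q.2) t +
          v t q.1 q.2 * deriv (fun s => v s q.1 q.2) t) (Ioc 0 L ×ˢ univ) ∧
      IntegrableOn (fun q : ℝ × ℝ => (1 / 4 - u t q.1 q.2 ^ 2 + v t q.1 q.2 ^ 2) / 2) (Ioc 0 L ×ˢ univ) ∧
      IntegrableOn (fun q : ℝ × ℝ => dX (u t) q.1 q.2 ^ 2 + dY (u t) q.1 q.2 ^ 2 + dX (v t) q.1 q.2 ^ 2 +
          dY (v t) q.1 q.2 ^ 2) (Ioc 0 L ×ˢ univ) ∧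
      ∫ q in Ioc 0 L ×ˢ univ, (u t q.1 q.2 * deriv (fun s => u s q.1 q.2) t +
          v t q.1 q.2 * deriv (fun s => v s q.1 q.2) t) =
        (∫ q in Ioc 0 L ×ˢ univ, (1 / 4 - u t q.1 q.2 ^ 2 + v t q.1 q.2 ^ 2) / 2) -
          ν * ∫ q in Ioc 0 L ×ˢ univ, (dX (u t) q.1 q.2 ^ 2 + dY (u t) q.1 q.2 ^ 2 +
            dX (v t) q.1 q.2 ^ 2 + dY (v t) q.1 q.2 ^ 2) := by
  intro ν L t C k u v p hL ht hk h hST hT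
  have ht' : t ∈ Ioi (0:ℝ) := ht
  -- constants and the weight
  have hC : 0 ≤ C := hST.nonneg
  have he1 : ∀ y : ℝ, Real.exp (-k * |y|) ≤ 1 := exp_neg_mul_abs_le_one hk
  have he0 : ∀ y : ℝ, 0 < Real.exp (-k * |y|) := fun y => Real.exp_pos _
  -- atomic bounds at time `t`
  have hu : ∀ x y, |u t x y| ≤ 1 + C := hST.abs_u_le hk
  have hv : ∀ x y, |v t x y| ≤ C * Real.exp (-k * |y|) := hST.abs_v_le
  have hvC : ∀ x y, |v t x y| ≤ C := hST.abs_v_le_const hk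
  have hux : ∀ x y, |dX (u t) x y| ≤ C * Real.exp (-k * |y|) := hST.abs_dX_u_le
  have huy : ∀ x y, |dY (u t) x y| ≤ C * Real.exp (-k * |y|) := hST.abs_dY_u_le
  have hvx : ∀ x y, |dX (v t) x y| ≤ C * Real.exp (-k * |y|) := hST.abs_dX_v_le
  have hvy : ∀ x y, |dY (v t) x y| ≤ C * Real.exp (-k * |y|) := hST.abs_dY_v_le
  have hlu : ∀ x y, |lap (u t) x y| ≤ C * Real.exp (-k * |y|) := hST.abs_lap_u_le
  have hlv : ∀ x y, |lap (v t) x y| ≤ C * Real.exp (-k * |y|) := hST.abs_lap_v_le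
  have hut : ∀ x y, |deriv (fun s => u s x y) t| ≤ C * Real.exp (-k * |y|) := fun x y => by
    linarith [hT x y, abs_nonneg (deriv (fun s => v s x y) t)]
  have hvt : ∀ x y, |deriv (fun s => v s x y) t| ≤ C * Real.exp (-k * |y|) := fun x y => by
    linarith [hT x y, abs_nonneg (deriv (fun s => u s x y) t)]
  have hleC : ∀ {z : ℝ} {y : ℝ}, |z| ≤ C * Real.exp (-k * |y|) → |z| ≤ C := fun hz =>
    hz.trans (mul_le_of_le_one_right hC (he1 _))
  -- regularity atoms
  have hu2 := h.contDiff_u ht'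
  have hv2 := h.contDiff_v ht'
  have hp1 := h.contDiff_p ht'
  have hu1 : ContDiff ℝ 1 (fun q : ℝ × ℝ => u t q.1 q.2) := hu2.of_le one_le_two
  have hv1 : ContDiff ℝ 1 (fun q : ℝ × ℝ => v t q.1 q.2) := hv2.of_le one_le_two
  have cu : Continuous (fun q : ℝ × ℝ => u t q.1 q.2) := hu2.continuous
  have cv : Continuous (fun q : ℝ × ℝ => v t q.1 q.2) := hv2.continuous
  have cux := continuous_dX hu1; have cuy := continuous_dY hu1
  have cvx := continuous_dX hv1; have cvy := continuous_dY hv1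
  have cp : Continuous (fun q : ℝ × ℝ => p t q.1 q.2) := hp1.continuous
  have cpx := continuous_dX hp1; have cpy := continuous_dY hp1
  have cut : Continuous (fun q : ℝ × ℝ => deriv (fun s => u s q.1 q.2) t) :=
    continuous_deriv_time isOpen_Ioi h.contDiffOn_u ht'
  have cvt : Continuous (fun q : ℝ × ℝ => deriv (fun s => v s q.1 q.2) t) :=
    continuous_deriv_time isOpen_Ioi h.contDiffOn_v ht'
  have cvy1 : Continuous (fun q : ℝ × ℝ => v t q.1 q.2 - 1 * q.2) :=
    cv.sub (continuous_const.mul continuous_snd)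
  -- the momentum equations with the two-sided time derivative
  have hmx : ∀ x y, deriv (fun s => u s x y) t + u t x y * dX (u t) x y +
      (v t x y - 1 * y) * dY (u t) x y = -dX (p t) x y + ν * lap (u t) x y := fun x y => by
    have e := h.momentum_x t ht' x y
    rwa [dT_of_isOpen isOpen_Ioi u ht'] at e
  have hmy : ∀ x y, deriv (fun s => v s x y) t + u t x y * dX (v t) x y +
      (v t x y - 1 * y) * dY (v t) x y - 1 * v t x y = -dY (p t) x y + ν * lap (v t) x y := fun x y => by
    have e := h.momentum_y t ht' x y
    rwa [dT_of_isOpen isOpen_Ioi v ht'] at e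
  -- the pressure gradient, read off the momentum equations
  set K : ℝ := 2 * C + (1 + C) * C + (C + 1) * C + |ν| * C with hK_def
  have hK0 : 0 ≤ K := by positivity
  have hvy1 : ∀ x y, |v t x y - 1 * y| ≤ (C + 1) * (1 + |y|) := fun x y => by
    have h1 := abs_sub_mul_le_linear (γ := 1) y hC (hvC x y)
    rwa [abs_one] at h1
  have hpx : ∀ x y, |dX (p t) x y| ≤ K * ((1 + |y|) ^ 2 * Real.exp (-k * |y|)) := by
    intro x y
    have e : dX (p t) x y = -deriv (fun s => u s x y) t - u t x y * dX (u t) x y -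
        (v t x y - 1 * y) * dY (u t) x y + ν * lap (u t) x y := by linarith [hmx x y]
    rw [e]
    set E : ℝ := Real.exp (-k * |y|) with hE_def
    set W : ℝ := (1 + |y|) ^ 2 * Real.exp (-k * |y|) with hW_def
    have w1 : E ≤ W := exp_le_one_add_abs_sq_mul_exp k y
    have w2 : (1 + |y|) * E ≤ W := one_add_abs_mul_exp_le_sq k y
    have i0 : |-deriv (fun s => u s x y) t| ≤ C * E := by rw [abs_neg]; exact hut x y
    have i1 : |u t x y * dX (u t) x y| ≤ (1 + C) * (C * E) := by
      rw [abs_mul]; exact mul_le_mul (hu x y) (hux x y) (abs_nonneg _) (by linarith)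
    have i2 : |(v t x y - 1 * y) * dY (u t) x y| ≤ (C + 1) * (1 + |y|) * (C * E) := by
      rw [abs_mul]; exact mul_le_mul (hvy1 x y) (huy x y) (abs_nonneg _) (by positivity)
    have i3 : |ν * lap (u t) x y| ≤ |ν| * (C * E) := by
      rw [abs_mul]; exact mul_le_mul_of_nonneg_left (hlu x y) (abs_nonneg ν)
    have j0 := mul_le_mul_of_nonneg_left w1 hC
    have j1 := mul_le_mul_of_nonneg_left w1 (by positivity : 0 ≤ (1 + C) * C)
    have j2 := mul_le_mul_of_nonneg_left w2 (by positivity : 0 ≤ (C + 1) * C)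
    have j3 := mul_le_mul_of_nonneg_left w1 (by positivity : 0 ≤ |ν| * C)
    calc _ ≤ |-deriv (fun s => u s x y) t - u t x y * dX (u t) x y -
          (v t x y - 1 * y) * dY (u t) x y| + |ν * lap (u t) x y| := abs_add_le _ _
      _ ≤ |-deriv (fun s => u s x y) t - u t x y * dX (u t) x y| +
          |(v t x y - 1 * y) * dY (u t) x y| + |ν * lap (u t) x y| := by
          gcongr; exact abs_sub _ _
      _ ≤ |-deriv (fun s => u s x y) t| + |u t x y * dX (u t) x y| +
          |(v t x y - 1 * y) * dY (u t) x y| + |ν * lap (u t) x y| := by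
          gcongr; exact abs_sub _ _
      _ ≤ C * E + (1 + C) * (C * E) + (C + 1) * (1 + |y|) * (C * E) + |ν| * (C * E) := by
          gcongr
      _ ≤ C * W + (1 + C) * C * W + (C + 1) * C * W + |ν| * C * W := by linarith
      _ ≤ K * W := by
          rw [hK_def]
          have hW0 : 0 ≤ W := by positivity
          nlinarith
  have hpy : ∀ x y, |dY (p t) x y| ≤ K * (1 + |y|) := by
    intro x y
    have e : dY (p t) x y = -deriv (fun s => v s x y) t - u t x y * dX (v t) x y -
        (v t x y - 1 * y) * dY (v t) x y + 1 * v t x y + ν * lap (v t) x y := by linarith [hmy x y]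
    rw [e]
    have i0 : |-deriv (fun s => v s x y) t| ≤ C := by rw [abs_neg]; exact hleC (hvt x y)
    have i1 : |u t x y * dX (v t) x y| ≤ (1 + C) * C := by
      rw [abs_mul]; exact mul_le_mul (hu x y) (hleC (hvx x y)) (abs_nonneg _) (by linarith)
    have i2 : |(v t x y - 1 * y) * dY (v t) x y| ≤ (C + 1) * (1 + |y|) * C := by
      rw [abs_mul]; exact mul_le_mul (hvy1 x y) (hleC (hvy x y)) (abs_nonneg _) (by positivity)
    have i3 : |1 * v t x y| ≤ C := by rw [one_mul]; exact hvC x y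
    have i4 : |ν * lap (v t) x y| ≤ |ν| * C := by
      rw [abs_mul]; exact mul_le_mul_of_nonneg_left (hleC (hlv x y)) (abs_nonneg ν)
    have hy := abs_nonneg y
    calc _ ≤ |-deriv (fun s => v s x y) t - u t x y * dX (v t) x y -
          (v t x y - 1 * y) * dY (v t) x y + 1 * v t x y| + |ν * lap (v t) x y| := abs_add_le _ _
      _ ≤ |-deriv (fun s => v s x y) t - u t x y * dX (v t) x y -
          (v t x y - 1 * y) * dY (v t) x y| + |1 * v t x y| + |ν * lap (v t) x y| := by
          gcongr; exact abs_add_le _ _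
      _ ≤ |-deriv (fun s => v s x y) t - u t x y * dX (v t) x y| +
          |(v t x y - 1 * y) * dY (v t) x y| + |1 * v t x y| + |ν * lap (v t) x y| := by
          gcongr; exact abs_sub _ _
      _ ≤ |-deriv (fun s => v s x y) t| + |u t x y * dX (v t) x y| +
          |(v t x y - 1 * y) * dY (v t) x y| + |1 * v t x y| + |ν * lap (v t) x y| := by
          gcongr; exact abs_sub _ _
      _ ≤ C + (1 + C) * C + (C + 1) * (1 + |y|) * C + C + |ν| * C := by gcongr
      _ ≤ K * (1 + |y|) := by
          rw [hK_def]
          nlinarith [mul_nonneg hC hy, mul_nonneg (mul_nonneg hC hC) hy,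
            mul_nonneg (mul_nonneg (abs_nonneg ν) hC) hy]
  -- the pressure grows at most quadratically across the layer
  obtain ⟨M₀, hM₀⟩ := exists_abs_le_of_periodic (g := fun x => p t x 0) hL (continuous_slice_x cp 0)
    (fun x => h.periodic_p t ht' x 0)
  have hM₀0 : 0 ≤ M₀ := (abs_nonneg _).trans (hM₀ 0)
  have hP : ∀ x y, |p t x y| ≤ (M₀ + K) * (1 + |y|) ^ 2 := by
    intro x y
    have hmv := abs_sub_zero_le_of_abs_deriv_le (g := fun s => p t x s)
      (fun s => (hasDerivAt_dY_of_contDiff hp1 one_ne_zero x s).differentiableAt)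
      (fun s => hpy x s) y
    have h0 := hM₀ x
    have hy := abs_nonneg y
    calc |p t x y| ≤ |p t x 0| + |p t x y - p t x 0| := by
          have h3 := abs_add_le (p t x 0) (p t x y - p t x 0)
          rwa [add_sub_cancel] at h3
      _ ≤ M₀ + K * (1 + |y|) * |y| := add_le_add h0 hmv
      _ ≤ (M₀ + K) * (1 + |y|) ^ 2 := by nlinarith [mul_nonneg hK0 hy, mul_nonneg hM₀0 hy]
  -- the excess energy density `e = (u² + v² − ¼)/2`
  set φ : ℝ → ℝ → ℝ := fun x y => (u t x y ^ 2 + v t x y ^ 2 - 1 / 4) / 2 with hφ_def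
  have hφ1 : ContDiff ℝ 1 (fun q : ℝ × ℝ => φ q.1 q.2) := contDiff_energyDensity hu1 hv1
  have cφ : Continuous (fun q : ℝ × ℝ => φ q.1 q.2) := hφ1.continuous
  have cφx := continuous_dX hφ1
  have cφy := continuous_dY hφ1
  have hφx : ∀ x y, dX φ x y = u t x y * dX (u t) x y + v t x y * dX (v t) x y := fun x y =>
    dX_energyDensity (hasDerivAt_dX_of_contDiff hu2 two_ne_zero x y).differentiableAt
      (hasDerivAt_dX_of_contDiff hv2 two_ne_zero x y).differentiableAt
  have hφy : ∀ x y, dY φ x y = u t x y * dY (u t) x y + v t x y * dY (v t) x y := fun x y =>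
    dY_energyDensity (hasDerivAt_dY_of_contDiff hu2 two_ne_zero x y).differentiableAt
      (hasDerivAt_dY_of_contDiff hv2 two_ne_zero x y).differentiableAt
  have hperφ : ∀ x y, φ (x + L) y = φ x y := fun x y => by
    simp only [hφ_def, h.periodic_u t ht', h.periodic_v t ht']
  have hφ0 : ∀ x y, |φ x y| ≤ C / 2 * Real.exp (-k * |y|) := fun x y => hST.abs_energyDensity_le x y
  have hφ0' : ∀ x y, |φ x y| ≤ C / 2 := fun x y =>
    (hφ0 x y).trans (mul_le_of_le_one_right (by positivity) (he1 y))
  have hφx0 : ∀ x y, |dX φ x y| ≤ (1 + 2 * C) * C * Real.exp (-k * |y|) := fun x y => by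
    rw [hφx]
    have i1 : |u t x y * dX (u t) x y| ≤ (1 + C) * (C * Real.exp (-k * |y|)) := by
      rw [abs_mul]; exact mul_le_mul (hu x y) (hux x y) (abs_nonneg _) (by linarith)
    have i2 : |v t x y * dX (v t) x y| ≤ C * (C * Real.exp (-k * |y|)) := by
      rw [abs_mul]; exact mul_le_mul (hvC x y) (hvx x y) (abs_nonneg _) hC
    calc _ ≤ |u t x y * dX (u t) x y| + |v t x y * dX (v t) x y| := abs_add_le _ _
      _ ≤ (1 + C) * (C * Real.exp (-k * |y|)) + C * (C * Real.exp (-k * |y|)) := add_le_add i1 i2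
      _ = (1 + 2 * C) * C * Real.exp (-k * |y|) := by ring
  have hφy0 : ∀ x y, |dY φ x y| ≤ (1 + 2 * C) * C * Real.exp (-k * |y|) := fun x y => by
    rw [hφy]
    have i1 : |u t x y * dY (u t) x y| ≤ (1 + C) * (C * Real.exp (-k * |y|)) := by
      rw [abs_mul]; exact mul_le_mul (hu x y) (huy x y) (abs_nonneg _) (by linarith)
    have i2 : |v t x y * dY (v t) x y| ≤ C * (C * Real.exp (-k * |y|)) := by
      rw [abs_mul]; exact mul_le_mul (hvC x y) (hvy x y) (abs_nonneg _) hC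
    calc _ ≤ |u t x y * dY (u t) x y| + |v t x y * dY (v t) x y| := abs_add_le _ _
      _ ≤ (1 + C) * (C * Real.exp (-k * |y|)) + C * (C * Real.exp (-k * |y|)) := add_le_add i1 i2
      _ = (1 + 2 * C) * C * Real.exp (-k * |y|) := by ring
  -- integrability on the strip: transport
  have hvy1' : ∀ x y, |v t x y - 1 * y| ≤ (C + 1) * (1 + |y|) ^ 2 := fun x y =>
    abs_le_mul_one_add_abs_sq_of_abs_le_linear y (by positivity) (hvy1 x y)
  have iT1 : IntegrableOn (fun q : ℝ × ℝ => u t q.1 q.2 * dX φ q.1 q.2) (Ioc 0 L ×ˢ univ) :=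
    integrableOn_strip_of_abs_le_exp (cu.mul cφx) (by positivity : 0 ≤ (1 + C) * ((1 + 2 * C) * C)) hk
      fun x _ y => by
        rw [abs_mul]
        calc |u t x y| * |dX φ x y| ≤ (1 + C) * ((1 + 2 * C) * C * Real.exp (-k * |y|)) :=
              mul_le_mul (hu x y) (hφx0 x y) (abs_nonneg _) (by linarith)
          _ = (1 + C) * ((1 + 2 * C) * C) * Real.exp (-k * |y|) := by ring
  have iT2 : IntegrableOn (fun q : ℝ × ℝ => dX (u t) q.1 q.2 * φ q.1 q.2) (Ioc 0 L ×ˢ univ) :=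
    integrableOn_strip_of_abs_le_exp (cux.mul cφ) (by positivity : 0 ≤ C * (C / 2)) hk
      fun x _ y => by
        rw [abs_mul]
        calc |dX (u t) x y| * |φ x y| ≤ C * Real.exp (-k * |y|) * (C / 2) :=
              mul_le_mul (hux x y) (hφ0' x y) (abs_nonneg _) (by positivity)
          _ = C * (C / 2) * Real.exp (-k * |y|) := by ring
  have iT3 : IntegrableOn (fun q : ℝ × ℝ => (v t q.1 q.2 - 1 * q.2) * dY φ q.1 q.2) (Ioc 0 L ×ˢ univ) :=
    integrableOn_strip_of_abs_le_sq_exp (cvy1.mul cφy) hk fun x _ y =>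
      abs_mul_le_weight' y (by positivity) (hvy1' x y) (hφy0 x y)
  have iT4 : IntegrableOn (fun q : ℝ × ℝ => (dY (v t) q.1 q.2 - 1) * φ q.1 q.2) (Ioc 0 L ×ˢ univ) :=
    integrableOn_strip_of_abs_le_exp ((cvy.sub continuous_const).mul cφ)
      (by positivity : 0 ≤ (C + 1) * (C / 2)) hk fun x _ y => by
        rw [abs_mul]
        have h1 : |dY (v t) x y - 1| ≤ C + 1 := (abs_sub _ _).trans (by
          rw [abs_one]; exact add_le_add (hleC (hvy x y)) le_rfl)
        calc |dY (v t) x y - 1| * |φ x y| ≤ (C + 1) * (C / 2 * Real.exp (-k * |y|)) :=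
              mul_le_mul h1 (hφ0 x y) (abs_nonneg _) (by positivity)
          _ = (C + 1) * (C / 2) * Real.exp (-k * |y|) := by ring
  have iT5 : IntegrableOn (fun q : ℝ × ℝ => (v t q.1 q.2 - 1 * q.2) * φ q.1 q.2) (Ioc 0 L ×ˢ univ) :=
    integrableOn_strip_of_abs_le_sq_exp (cvy1.mul cφ) hk fun x _ y =>
      abs_mul_le_weight' y (by positivity) (hvy1' x y) (hφ0 x y)
  -- integrability on the strip: pressure
  have iP1 : IntegrableOn (fun q : ℝ × ℝ => u t q.1 q.2 * dX (p t) q.1 q.2) (Ioc 0 L ×ˢ univ) :=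
    integrableOn_strip_of_abs_le_sq_exp (cu.mul cpx) hk (C := (1 + C) * K) fun x _ y => by
      rw [abs_mul]
      calc |u t x y| * |dX (p t) x y| ≤ (1 + C) * (K * ((1 + |y|) ^ 2 * Real.exp (-k * |y|))) :=
            mul_le_mul (hu x y) (hpx x y) (abs_nonneg _) (by linarith)
        _ = (1 + C) * K * ((1 + |y|) ^ 2 * Real.exp (-k * |y|)) := by ring
  have iP2 : IntegrableOn (fun q : ℝ × ℝ => dX (u t) q.1 q.2 * p t q.1 q.2) (Ioc 0 L ×ˢ univ) :=
    integrableOn_strip_of_abs_le_sq_exp (cux.mul cp) hk fun x _ y =>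
      abs_mul_le_weight y hC (hux x y) (hP x y)
  have iP3 : IntegrableOn (fun q : ℝ × ℝ => v t q.1 q.2 * dY (p t) q.1 q.2) (Ioc 0 L ×ˢ univ) :=
    integrableOn_strip_of_abs_le_sq_exp (cv.mul cpy) hk fun x _ y =>
      abs_mul_le_weight y hC (hv x y) (abs_le_mul_one_add_abs_sq_of_abs_le_linear y hK0 (hpy x y))
  have iP4 : IntegrableOn (fun q : ℝ × ℝ => dY (v t) q.1 q.2 * p t q.1 q.2) (Ioc 0 L ×ˢ univ) :=
    integrableOn_strip_of_abs_le_sq_exp (cvy.mul cp) hk fun x _ y =>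
      abs_mul_le_weight y hC (hvy x y) (hP x y)
  have iP5 : IntegrableOn (fun q : ℝ × ℝ => v t q.1 q.2 * p t q.1 q.2) (Ioc 0 L ×ˢ univ) :=
    integrableOn_strip_of_abs_le_sq_exp (cv.mul cp) hk fun x _ y =>
      abs_mul_le_weight y hC (hv x y) (hP x y)
  -- integrability on the strip: time derivative, stretching, work density, gradient, viscosity
  have iL : IntegrableOn (fun q : ℝ × ℝ => u t q.1 q.2 * deriv (fun s => u s q.1 q.2) t +
      v t q.1 q.2 * deriv (fun s => v s q.1 q.2) t) (Ioc 0 L ×ˢ univ) :=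
    integrableOn_strip_of_abs_le_exp ((cu.mul cut).add (cv.mul cvt))
      (by positivity : 0 ≤ (1 + C) * C + C * C) hk fun x _ y => by
        have i1 : |u t x y * deriv (fun s => u s x y) t| ≤ (1 + C) * (C * Real.exp (-k * |y|)) := by
          rw [abs_mul]; exact mul_le_mul (hu x y) (hut x y) (abs_nonneg _) (by linarith)
        have i2 : |v t x y * deriv (fun s => v s x y) t| ≤ C * (C * Real.exp (-k * |y|)) := by
          rw [abs_mul]; exact mul_le_mul (hvC x y) (hvt x y) (abs_nonneg _) hC
        calc _ ≤ |u t x y * deriv (fun s => u s x y) t| + |v t x y * deriv (fun s => v s x y) t| :=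
              abs_add_le _ _
          _ ≤ (1 + C) * (C * Real.exp (-k * |y|)) + C * (C * Real.exp (-k * |y|)) := add_le_add i1 i2
          _ = ((1 + C) * C + C * C) * Real.exp (-k * |y|) := by ring
  have ivv : IntegrableOn (fun q : ℝ × ℝ => v t q.1 q.2 ^ 2) (Ioc 0 L ×ˢ univ) :=
    integrableOn_strip_of_abs_le_exp (cv.pow 2) (by positivity : 0 ≤ C ^ 2) hk fun x _ y => by
      rw [abs_of_nonneg (sq_nonneg _)]; exact hST.sq_v_le hk x y
  have iW : IntegrableOn (fun q : ℝ × ℝ => (1 / 4 - u t q.1 q.2 ^ 2 + v t q.1 q.2 ^ 2) / 2)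
      (Ioc 0 L ×ˢ univ) :=
    integrableOn_strip_of_abs_le_exp (((continuous_const.sub (cu.pow 2)).add (cv.pow 2)).div_const 2)
      (by positivity : 0 ≤ C / 2 + C ^ 2) hk fun x _ y => hST.abs_workDensity_le hk x y
  have iφ : IntegrableOn (fun q : ℝ × ℝ => φ q.1 q.2) (Ioc 0 L ×ˢ univ) :=
    integrableOn_strip_of_abs_le_exp cφ (by positivity : 0 ≤ C / 2) hk fun x _ y => hφ0 x y
  have iG : IntegrableOn (fun q : ℝ × ℝ => dX (u t) q.1 q.2 ^ 2 + dY (u t) q.1 q.2 ^ 2 +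
      dX (v t) q.1 q.2 ^ 2 + dY (v t) q.1 q.2 ^ 2) (Ioc 0 L ×ˢ univ) :=
    integrableOn_strip_of_abs_le_exp ((((cux.pow 2).add (cuy.pow 2)).add (cvx.pow 2)).add (cvy.pow 2))
      (by positivity : 0 ≤ C ^ 2) hk fun x _ y => hST.abs_gradSq_le hk x y
  obtain ⟨iVu, iGu, hVu⟩ := stub_strainWorkIdentity_viscous L k (1 + C) C (u t) hL hk hu2
    (h.periodic_u t ht') hu hST.abs_grad_u_le hlu
  obtain ⟨iVv, iGv, hVv⟩ := stub_strainWorkIdentity_viscous L k C C (v t) hL hk hv2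
    (h.periodic_v t ht') hvC hST.abs_grad_v_le hlv
  -- the four identities: transport, pressure, viscosity (u), viscosity (v)
  have hTr : ∫ q in Ioc 0 L ×ˢ univ,
      (u t q.1 q.2 * dX φ q.1 q.2 + (v t q.1 q.2 - 1 * q.2) * dY φ q.1 q.2) =
      1 * ∫ q in Ioc 0 L ×ˢ univ, φ q.1 q.2 :=
    integral_strip_transport hL.le hu1 hv1 hφ1 (h.divFree t ht') (h.periodic_u t ht') hperφ
      iT1 iT2 iT3 iT4 iT5
  have hPr : ∫ q in Ioc 0 L ×ˢ univ,
      (u t q.1 q.2 * dX (p t) q.1 q.2 + v t q.1 q.2 * dY (p t) q.1 q.2) = 0 :=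
    integral_strip_pressure_eq_zero hL.le hu1 hv1 hp1 (h.divFree t ht') (h.periodic_u t ht')
      (h.periodic_p t ht') iP1 iP2 iP3 iP4 iP5
  -- pair the momentum equations with `(u, v)`
  have hpt : ∀ q : ℝ × ℝ, u t q.1 q.2 * deriv (fun s => u s q.1 q.2) t +
      v t q.1 q.2 * deriv (fun s => v s q.1 q.2) t =
      -(u t q.1 q.2 * dX φ q.1 q.2 + (v t q.1 q.2 - 1 * q.2) * dY φ q.1 q.2)
      + v t q.1 q.2 ^ 2
      - (u t q.1 q.2 * dX (p t) q.1 q.2 + v t q.1 q.2 * dY (p t) q.1 q.2)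
      + ν * (u t q.1 q.2 * lap (u t) q.1 q.2 + v t q.1 q.2 * lap (v t) q.1 q.2) := by
    intro q
    rw [hφx, hφy]
    linear_combination (u t q.1 q.2) * hmx q.1 q.2 + (v t q.1 q.2) * hmy q.1 q.2
  have iT : IntegrableOn (fun q : ℝ × ℝ =>
      u t q.1 q.2 * dX φ q.1 q.2 + (v t q.1 q.2 - 1 * q.2) * dY φ q.1 q.2) (Ioc 0 L ×ˢ univ) :=
    iT1.add iT3
  have iP : IntegrableOn (fun q : ℝ × ℝ =>
      u t q.1 q.2 * dX (p t) q.1 q.2 + v t q.1 q.2 * dY (p t) q.1 q.2) (Ioc 0 L ×ˢ univ) := iP1.add iP3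
  have iV : IntegrableOn (fun q : ℝ × ℝ =>
      u t q.1 q.2 * lap (u t) q.1 q.2 + v t q.1 q.2 * lap (v t) q.1 q.2) (Ioc 0 L ×ˢ univ) := iVu.add iVv
  have i1 : IntegrableOn (fun q : ℝ × ℝ =>
      -(u t q.1 q.2 * dX φ q.1 q.2 + (v t q.1 q.2 - 1 * q.2) * dY φ q.1 q.2)) (Ioc 0 L ×ˢ univ) := iT.neg
  have i2 : IntegrableOn (fun q : ℝ × ℝ =>
      -(u t q.1 q.2 * dX φ q.1 q.2 + (v t q.1 q.2 - 1 * q.2) * dY φ q.1 q.2)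
      + v t q.1 q.2 ^ 2) (Ioc 0 L ×ˢ univ) := i1.add ivv
  have i3 : IntegrableOn (fun q : ℝ × ℝ =>
      -(u t q.1 q.2 * dX φ q.1 q.2 + (v t q.1 q.2 - 1 * q.2) * dY φ q.1 q.2)
      + v t q.1 q.2 ^ 2
      - (u t q.1 q.2 * dX (p t) q.1 q.2 + v t q.1 q.2 * dY (p t) q.1 q.2)) (Ioc 0 L ×ˢ univ) := i2.sub iP
  have i4 : IntegrableOn (fun q : ℝ × ℝ =>
      ν * (u t q.1 q.2 * lap (u t) q.1 q.2 + v t q.1 q.2 * lap (v t) q.1 q.2)) (Ioc 0 L ×ˢ univ) :=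
    iV.const_mul ν
  have hsplit : ∫ q in Ioc 0 L ×ˢ univ, (u t q.1 q.2 * deriv (fun s => u s q.1 q.2) t +
      v t q.1 q.2 * deriv (fun s => v s q.1 q.2) t) =
      -(∫ q in Ioc 0 L ×ˢ univ,
          (u t q.1 q.2 * dX φ q.1 q.2 + (v t q.1 q.2 - 1 * q.2) * dY φ q.1 q.2))
      + (∫ q in Ioc 0 L ×ˢ univ, v t q.1 q.2 ^ 2)
      - (∫ q in Ioc 0 L ×ˢ univ, (u t q.1 q.2 * dX (p t) q.1 q.2 + v t q.1 q.2 * dY (p t) q.1 q.2))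
      + ν * ((∫ q in Ioc 0 L ×ˢ univ, u t q.1 q.2 * lap (u t) q.1 q.2) +
          ∫ q in Ioc 0 L ×ˢ univ, v t q.1 q.2 * lap (v t) q.1 q.2) := by
    rw [integral_congr_ae (Eventually.of_forall hpt), integral_add i3 i4, integral_sub i2 iP,
      integral_add i1 ivv, MeasureTheory.integral_neg, MeasureTheory.integral_const_mul, integral_add iVu iVv]
  -- the two right-hand integrals
  have hJ : ∫ q in Ioc 0 L ×ˢ univ, (1 / 4 - u t q.1 q.2 ^ 2 + v t q.1 q.2 ^ 2) / 2 =
      -(∫ q in Ioc 0 L ×ˢ univ, φ q.1 q.2) + ∫ q in Ioc 0 L ×ˢ univ, v t q.1 q.2 ^ 2 := by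
    have iφn : IntegrableOn (fun q : ℝ × ℝ => -φ q.1 q.2) (Ioc 0 L ×ˢ univ) := iφ.neg
    rw [← MeasureTheory.integral_neg, ← integral_add iφn ivv]
    refine integral_congr_ae (Eventually.of_forall fun q => ?_)
    simp only [hφ_def]
    ring
  have hG : ∫ q in Ioc 0 L ×ˢ univ, (dX (u t) q.1 q.2 ^ 2 + dY (u t) q.1 q.2 ^ 2 +
      dX (v t) q.1 q.2 ^ 2 + dY (v t) q.1 q.2 ^ 2) =
      (∫ q in Ioc 0 L ×ˢ univ, (dX (u t) q.1 q.2 ^ 2 + dY (u t) q.1 q.2 ^ 2)) +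
        ∫ q in Ioc 0 L ×ˢ univ, (dX (v t) q.1 q.2 ^ 2 + dY (v t) q.1 q.2 ^ 2) := by
    rw [← integral_add iGu iGv]
    refine integral_congr_ae (Eventually.of_forall fun q => ?_)
    simp only
    ring
  refine ⟨iL, iW, iG, ?_⟩
  rw [hsplit, hTr, hPr, hVu, hVv, hJ, hG]
  ring

end Slice

end Summit.AnomalousDissipation.AnomalousDissipation.Theorems.StrainedLayerLaw.StrainWorkSumRule

end
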